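/-
Copyright (c) 2026. All rights reserved.
Released under Apache 2.0 license as described in the file LICENSE.
Authors: solo-Langlands-informed (ideation tier, family 6).
-/
import Literature.NumberTheory.PAdicHodge.SemiInvariantLevelAbsGalois
import HarnessLib

/-!
# Unramified characters with coefficients have UNIT `ℂ_F`-periods at every embedding

`Proofs`-style file (theorems only).  Topic `NumberTheory/PAdicHodge`; namespace
`Literature.NumberTheory.PAdicHodge.UnramifiedCharacterPeriods`.

**What is printed.**  Serre (1968), Ch. III, App. A.1–A.2 (after Tate 1967, §3.3), Sen (1973), Fontaine
(Astérisque 223, Exp. III §1.5): an unramified character `μ : Γ_F → E×` with coefficients in a finite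
`E/ℚ_p` is `ℂ_F`-admissible **of Hodge–Tate weight `0`**: for every `ℚ_p`-embedding `j : E → F̄` there
is `y ∈ ℂ_F`, `y ≠ 0`, with `y = j(μ σ) · σ(y)` whenever `σ ∘ j = j` — no cyclotomic factor (Lang's
theorem / Hilbert 90 over `𝒪̂_{F^{nr}}`).

**What is proved here.**  `exists_unit_period_at_embedding` (and its `→ₜ*`/subfield forms) — exactly
this, sharpening the tree's `DeRhamRankOne.exists_theta_period_of_unramified` (file
`UnramifiedCharacterThetaPeriods`), whose period carries an unspecified cyclotomic exponent.  Route: an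
integral frame `r : Γ_F → GL_N(ℤ_p)` of the regular representation of `μ` in a basis `b` of `E/ℚ_p`
(`DegreeOneLevel.exists_basis_integralFrame_character`), a unit period matrix `Y` over `ℂ_F`,
`σ(Y) = R(σ⁻¹) Y` (`UnramifiedUnitPeriods.exists_isUnit_forall_map_smul_eq_mul`), and the row vector
`β = (j(b_k))_k`, which satisfies `j(μ σ) β = β R(σ)`; then every entry of `β Y` is a period of `j ∘ μ` on
the stabiliser of `j`, and `β Y ≠ 0` since `Y` is invertible and `β ≠ 0`.

## References
* [SerreAbelianLadic1968] J.-P. Serre, *Abelian ℓ-adic representations and elliptic curves* (1968), Ch. III, App. A.1–A.2.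
* [Tate1967] J. Tate, *p-divisible groups* (1967), §3.3.
* [FontaineAsterisque223III] J.-M. Fontaine, Astérisque 223 (1994), Exp. III §1.5.
* [SerreLocalFields1979] J.-P. Serre, *Local Fields*, GTM 67, Ch. XIII §5 (Lang's theorem).
-/

noncomputable section

open Field ValuativeRel Matrix
open scoped MatrixGroups

namespace Literature.NumberTheory.PAdicHodge

open Literature.NumberTheory.GaloisRepresentations
open Literature.NumberTheory.GaloisRepresentations.IsNonarchimedeanLocalField

namespace UnramifiedCharacterPeriods

variable {F : Type} [Field F] [ValuativeRel F] [TopologicalSpace F] [IsNonarchimedeanLocalField F]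
  {p : ℕ} [Fact p.Prime] [Algebra ℚ_[p] F]

/-- **Unramified characters have unit `ℂ_F`-periods at every embedding.**  Let `E` be a
finite-dimensional Hausdorff topological `ℚ_p`-algebra which is a field, `μ : Γ_F → Eˣ` a continuous
character trivial on the inertia group, and `j : E → F̄` a `ℚ_p`-embedding.  Then there is `y ∈ ℂ_F`,
`y ≠ 0`, with `y = j(μ σ) · σ(y)` for every `σ ∈ Γ_F` with `σ ∘ j = j` (pointwise: `σ • j x = j x`).
[cite: SerreAbelianLadic1968, Ch. III §A.1–A.2] [cite: FontaineAsterisque223III, Exp. III §1.5]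
[cite: SerreLocalFields1979, Ch. XIII §5] -/
theorem exists_unit_period_at_embedding {E : Type} [Field E] [Algebra ℚ_[p] E]
    [TopologicalSpace E] [IsTopologicalRing E] [ContinuousSMul ℚ_[p] E] [T2Space E]
    [FiniteDimensional ℚ_[p] E] (μ : absoluteGaloisGroup F →* Eˣ) (hμc : Continuous μ)
    (hμI : ∀ σ ∈ absInertia F, μ σ = 1) (j : E →ₐ[ℚ_[p]] AlgebraicClosure F) :
    ∃ y : CompletedAlgClosure F, y ≠ 0 ∧
      ∀ σ : absoluteGaloisGroup F, (∀ x : E, σ • j x = j x) →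
        y = algClosureToC F (j (μ σ : E)) * σ • y := by
  classical
  obtain ⟨b, r, hrI, hL⟩ := DegreeOneLevel.exists_basis_integralFrame_character (F := F) (p := p) μ hμc hμI
  obtain ⟨Y, hYu, hY⟩ := UnramifiedUnitPeriods.exists_isUnit_forall_map_smul_eq_mul r hrI
  -- notation: `R σ` = `r σ` read in `ℂ_F`, `J = (F̄ → ℂ_F) ∘ j`, `β = J ∘ b`
  set c : ℤ_[p] → CompletedAlgClosure F :=
    fun a => algebraMap F (CompletedAlgClosure F) (algebraMap ℚ_[p] F (a : ℚ_[p])) with hc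
  set R : absoluteGaloisGroup F →
      Matrix (Fin (Module.finrank ℚ_[p] E)) (Fin (Module.finrank ℚ_[p] E)) (CompletedAlgClosure F) :=
    fun σ => ((r σ : GL (Fin (Module.finrank ℚ_[p] E)) ℤ_[p]) :
      Matrix (Fin (Module.finrank ℚ_[p] E)) (Fin (Module.finrank ℚ_[p] E)) ℤ_[p]).map c with hR
  set J : E →+* CompletedAlgClosure F := (algClosureToC F).comp j.toRingHom with hJ
  have hJapply : ∀ x : E, J x = algClosureToC F (j x) := fun x => rfl
  have hJsmul : ∀ (q : ℚ_[p]) (x : E), J (q • x) = algebraMap F (CompletedAlgClosure F) (algebraMap ℚ_[p] F q) * J x := by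
    intro q x
    rw [hJapply, hJapply, map_smul, Algebra.smul_def, map_mul,
      IsScalarTower.algebraMap_apply ℚ_[p] F (AlgebraicClosure F), algClosureToC_algebraMap]
  set β : Fin (Module.finrank ℚ_[p] E) → CompletedAlgClosure F := fun k => J (b k) with hβ
  -- (1) `J(μ σ) · β = β ᵥ* R(σ)` : apply `J` to `μ(σ) b_m = Σ_i L_b(μ σ)_{i m} b_i`
  have hβR : ∀ σ : absoluteGaloisGroup F, J (μ σ : E) • β = β ᵥ* R σ := by
    intro σ
    funext m
    have h1 : (μ σ : E) * b m = ∑ i, (Algebra.leftMulMatrix b (μ σ : E) i m) • b i := by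
      conv_lhs => rw [← b.sum_repr ((μ σ : E) * b m)]
      simp only [Algebra.leftMulMatrix_eq_repr_mul]
    have h2 := congrArg J h1
    rw [map_mul, map_sum] at h2
    simp only [Pi.smul_apply, smul_eq_mul, Matrix.vecMul, dotProduct]
    rw [hβ, h2]
    refine Finset.sum_congr rfl fun i _ => ?_
    rw [hJsmul, hL σ, Matrix.map_apply, mul_comm]
    rfl
  -- (2) `β ≠ 0`, hence `β ᵥ* Y ≠ 0`
  have hNpos : 0 < Module.finrank ℚ_[p] E := Module.finrank_pos
  have hβne : β ≠ 0 := by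
    intro h
    have h0 := congrFun h ⟨0, hNpos⟩
    rw [hβ, Pi.zero_apply, map_eq_zero_iff J J.injective] at h0
    exact b.ne_zero _ h0
  have hβY : β ᵥ* Y ≠ 0 := by
    intro h
    apply hβne
    have hdet : IsUnit Y.det := (Matrix.isUnit_iff_isUnit_det Y).1 hYu
    have h' : β ᵥ* (Y * Y⁻¹) = 0 := by rw [← Matrix.vecMul_vecMul, h, Matrix.zero_vecMul]
    rwa [Matrix.mul_nonsing_inv Y hdet, Matrix.vecMul_one] at h'
  obtain ⟨m, hm⟩ := Function.ne_iff.1 hβY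
  refine ⟨(β ᵥ* Y) m, hm, fun σ hσ => ?_⟩
  -- (3) semi-invariance of `β ᵥ* Y` on the stabiliser of `j`
  have hσβ : ∀ k, σ • β k = β k := by
    intro k
    show σ • algClosureToC F (j (b k)) = algClosureToC F (j (b k))
    rw [smul_algClosureToC, hσ]
  have hsmul : σ • (β ᵥ* Y) m = J (μ σ⁻¹ : E) * (β ᵥ* Y) m := by
    have hYσ : ∀ i, σ • Y i m = (R σ⁻¹ * Y) i m := fun i => by
      have h := congrFun (congrFun (hY σ) i) m
      rw [Matrix.map_apply] at h
      rw [h]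
    calc σ • (β ᵥ* Y) m = ∑ i, σ • β i * σ • Y i m := by
          simp only [Matrix.vecMul, dotProduct, Finset.smul_sum, smul_mul']
      _ = (β ᵥ* (R σ⁻¹ * Y)) m := by
          simp only [Matrix.vecMul, dotProduct, hσβ, hYσ]
      _ = ((J (μ σ⁻¹ : E) • β) ᵥ* Y) m := by rw [← Matrix.vecMul_vecMul, hβR σ⁻¹]
      _ = J (μ σ⁻¹ : E) * (β ᵥ* Y) m := by rw [Matrix.smul_vecMul, Pi.smul_apply, smul_eq_mul]
  rw [hsmul, ← mul_assoc, ← hJapply, ← map_mul, map_inv, Units.val_inv_eq_inv_val,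
    mul_inv_cancel₀ (Units.ne_zero _), map_one, one_mul]

/-- The same for a continuous monoid homomorphism `μ : Γ_F →ₜ* Eˣ`. [cite: SerreAbelianLadic1968, Ch. III §A.1–A.2] -/
theorem exists_unit_period_at_embedding' {E : Type} [Field E] [Algebra ℚ_[p] E]
    [TopologicalSpace E] [IsTopologicalRing E] [ContinuousSMul ℚ_[p] E] [T2Space E]
    [FiniteDimensional ℚ_[p] E] (μ : absoluteGaloisGroup F →ₜ* Eˣ)
    (hμI : ∀ σ ∈ absInertia F, μ σ = 1) (j : E →ₐ[ℚ_[p]] AlgebraicClosure F) :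
    ∃ y : CompletedAlgClosure F, y ≠ 0 ∧
      ∀ σ : absoluteGaloisGroup F, (∀ x : E, σ • j x = j x) →
        y = algClosureToC F (j (μ σ : E)) * σ • y :=
  exists_unit_period_at_embedding μ.toMonoidHom μ.continuous_toFun hμI j

/-- **Subfield form**: for `E ⊆ ℚ̄_p` an intermediate field finite over `ℚ_p` (the coefficient fields of
the tree's models `HasQlModel`), with its subspace topology. [cite: SerreAbelianLadic1968, Ch. III §A.1–A.2]
[cite: FontaineAsterisque223III, Exp. III §1.5] -/
theorem exists_unit_period_at_embedding_intermediateField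
    {E : IntermediateField ℚ_[p] (PadicAlgCl p)} [FiniteDimensional ℚ_[p] E]
    (μ : absoluteGaloisGroup F →ₜ* (E)ˣ) (hμI : ∀ σ ∈ absInertia F, μ σ = 1)
    (j : E →ₐ[ℚ_[p]] AlgebraicClosure F) :
    ∃ y : CompletedAlgClosure F, y ≠ 0 ∧
      ∀ σ : absoluteGaloisGroup F, (∀ x : E, σ • j x = j x) →
        y = algClosureToC F (j ((μ σ : (E)ˣ) : E)) * σ • y := by
  haveI : ContinuousSMul ℚ_[p] E := IntermediateField.continuousSMul_padicAlgCl E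
  exact exists_unit_period_at_embedding' μ hμI j

end UnramifiedCharacterPeriods

end Literature.NumberTheory.PAdicHodge
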